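import Mathlib.FieldTheory.PrimitiveElement
import Mathlib.RingTheory.Localization.Integer
import Mathlib.FieldTheory.Minpoly.IsIntegrallyClosed
import Literature.NumberTheory.Transcendental.BWValues
import Literature.NumberTheory.Transcendental.LiouvilleLinearForms
import HarnessLib

/-!
# Algebraic data for the Lindemann–Weierstrass measure: an integral generator, reduction modulo its minimal polynomial, Liouville's inequality

`Literature/NumberTheory/Transcendental/LWMeasureAlgebraicData.lean` — proofs and one concrete
definition (`red`), no named facts. First file of the construction ("Proposition principale",
§II of M. Ably, Acta Arith. 67 (1994)) behind the named fact
`Ably1994_lindemannWeierstrass_measure` (`LindemannWeierstrassMeasure.lean`).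

Ably works over the number field `K = ℚ(y₁, …, yₙ)`: the auxiliary polynomials `Q_{s,h,j}` of
§II have coefficients involving the powers `(h·y)^β`, `β < L`, of the interpolation points
`h·y = h₁y₁ + ⋯ + hₙyₙ`, and Siegel's lemma is applied with coefficients in `K` ([Wa2],
Lemme 1.3.1). The tree's elimination theory and criteria being over `ℚ`, the construction is run
here in `ℤ[w, X₁, …, Xₙ]` with ONE extra letter `w` standing for an integral generator `α` of `K`
(`c yᵢ = Rᵢ(α)`, `exists_generator`, from the primitive element theorem), every power of `α`
being reduced modulo the minimal polynomial `μ` of `α` to degree `< deg μ` with coefficients of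
controlled size (`red`, `aeval_red`, `natDegree_red_lt`, `zl1_red_le` — built on
`BrownawellWaldschmidt.redPoly` of `BWValues.lean`, the same device as Baker 1975, Ch. 2 (2)).
This keeps the `w`-degree of the family bounded by `[K:ℚ]`, which is what Ably's sharp degree
bound `deg Q_{s,h,j} ≤ 2nDM` (p. 41) requires.

Also here: `exists_lowerBound_linearForm` — Liouville's inequality
`|h₁y₁ + ⋯ + hₙyₙ| ≥ c (∑|hᵢ|)^{-k}` for `ℚ`-linearly independent algebraic `yᵢ` (Ably, p. 38:
"l'inégalité de la taille ([Wa2], 1.2.4) montre que `δ' ≥ exp(−[K:ℚ] log c₆M)`"; reduced to the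
tree's `exists_pos_le_sum_abs_pow_mul_norm_linearForm_pow` for `1, α, …, α^{d−1}`), which separates
the interpolation points `h·y` and excludes the degenerate case of the zero estimate (Lemme 3);
and `exists_root_separation` (the roots of `μ` are isolated), which pins the letter `w` to `α` on
small balls.

## References

* [Ably1994] M. Ably, *Une version quantitative du théorème de Lindemann–Weierstrass*, Acta Arith.
  67 (1994) 29–45, §II (pp. 33–41), esp. Lemme 1 (p. 35) and p. 38.
* [NesterenkoPhilippon2001] Yu. V. Nesterenko, P. Philippon (eds.), LNM 1752 (2001), Ch. 14
  §3.3, p. 258 (Liouville's inequality).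
* [BakerTNT1975] A. Baker, *Transcendental Number Theory* (1975), Ch. 2, eq. (2) (reduction of
  powers of an algebraic integer).
-/

noncomputable section

open scoped Polynomial
open Finset IntermediateField

namespace Literature.NumberTheory.Transcendental

namespace LWMeasure

open BrownawellWaldschmidt (redPoly aeval_redPoly natDegree_redPoly_lt zl1_redPoly_le)
open Chudnovsky (zl1 abs_coeff_le_zl1 pwnorm pwnorm_sum_le pl1Seminorm_apply
  normRingSeminorm_int_apply)

/-! ### Reduction modulo a monic integer polynomial -/

/-- `red μ p = ∑_k p_k · r_k`, `r_k = redPoly μ k ≡ X^k (mod μ)`: an integer polynomial of degree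
`< deg μ` taking the same value as `p` at every root of `μ`. [folklore] -/
def red (μ p : ℤ[X]) : ℤ[X] := p.sum fun k a => Polynomial.C a * redPoly μ k

/-- `red μ p` and `p` agree at the roots of `μ`. [folklore] -/
theorem aeval_red {A : Type*} [CommRing A] [Algebra ℤ A] (μ p : ℤ[X]) {ζ : A}
    (hζ : Polynomial.aeval ζ μ = 0) : Polynomial.aeval ζ (red μ p) = Polynomial.aeval ζ p := by
  have hp : Polynomial.aeval ζ p =
      p.sum fun k a => Polynomial.aeval ζ (Polynomial.C a * Polynomial.X ^ k) := by
    conv_lhs => rw [← Polynomial.sum_C_mul_X_pow_eq p]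
    rw [Polynomial.sum_def, Polynomial.sum_def, map_sum]
  rw [hp]
  unfold red
  rw [Polynomial.sum_def, Polynomial.sum_def, map_sum]
  refine sum_congr rfl fun k _ => ?_
  rw [map_mul, map_mul, aeval_redPoly μ hζ, map_pow, Polynomial.aeval_X]

/-- `deg (red μ p) < deg μ` for `μ` monic of positive degree. [folklore] -/
theorem natDegree_red_lt {μ : ℤ[X]} (hμ : μ.Monic) (he : 0 < μ.natDegree) (p : ℤ[X]) :
    (red μ p).natDegree < μ.natDegree := by
  unfold red
  rw [Polynomial.sum_def]
  refine lt_of_le_of_lt (Polynomial.natDegree_sum_le _ _) ?_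
  rw [Finset.fold_max_lt]
  refine ⟨he, fun k _ => ?_⟩
  refine lt_of_le_of_lt Polynomial.natDegree_mul_le ?_
  rw [Polynomial.natDegree_C, zero_add]
  exact natDegree_redPoly_lt hμ he k

/-- `‖red μ p‖₁ ≤ ‖p‖₁ (1 + ‖μ‖₁)^{deg p}`. [folklore] -/
theorem zl1_red_le (μ p : ℤ[X]) : zl1 (red μ p) ≤ zl1 p * (1 + zl1 μ) ^ p.natDegree := by
  have h1 : 1 ≤ 1 + zl1 μ := le_add_of_nonneg_right (apply_nonneg _ _)
  unfold red
  rw [Polynomial.sum_def]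
  calc zl1 (∑ k ∈ p.support, Polynomial.C (p.coeff k) * redPoly μ k)
      ≤ ∑ k ∈ p.support, zl1 (Polynomial.C (p.coeff k) * redPoly μ k) := by
        rw [pl1Seminorm_apply]
        refine (pwnorm_sum_le _ _ _).trans (le_of_eq ?_)
        rfl
    _ ≤ ∑ k ∈ p.support, |(p.coeff k : ℝ)| * (1 + zl1 μ) ^ p.natDegree := by
        refine sum_le_sum fun k hk => ?_
        refine (map_mul_le_mul zl1 _ _).trans ?_
        rw [Chudnovsky.zl1_C]
        refine mul_le_mul_of_nonneg_left ((zl1_redPoly_le μ k).trans ?_) (abs_nonneg _)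
        exact pow_le_pow_right₀ h1 (Polynomial.le_natDegree_of_mem_supp k hk)
    _ = zl1 p * (1 + zl1 μ) ^ p.natDegree := by
        have : zl1 p = ∑ k ∈ p.support, |(p.coeff k : ℝ)| := by
          rw [pl1Seminorm_apply, pwnorm]
          simp only [normRingSeminorm_int_apply]
        rw [← sum_mul, this]

/-- `‖red μ p‖₁ ≤ ‖p‖₁ (1 + ‖μ‖₁)^N` whenever `deg p ≤ N`. [folklore] -/
theorem zl1_red_le_of_natDegree_le (μ : ℤ[X]) {p : ℤ[X]} {N : ℕ} (hN : p.natDegree ≤ N) :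
    zl1 (red μ p) ≤ zl1 p * (1 + zl1 μ) ^ N := by
  have h1 : 1 ≤ 1 + zl1 μ := le_add_of_nonneg_right (apply_nonneg _ _)
  exact (zl1_red_le μ p).trans
    (mul_le_mul_of_nonneg_left (pow_le_pow_right₀ h1 hN) (apply_nonneg _ _))

/-! ### An integral generator for `ℚ(y₁, …, yₙ)` -/

/-- The primitive element theorem for an intermediate field, stated inside the big field: a
finite separable `K/F` inside `E` is `F(a)` for some `a ∈ K`. [folklore] -/
theorem exists_eq_adjoin_simple {F E : Type*} [Field F] [Field E] [Algebra F E]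
    (K : IntermediateField F E) [FiniteDimensional F K] [Algebra.IsSeparable F K] :
    ∃ a : E, a ∈ K ∧ K = F⟮a⟯ := by
  obtain ⟨a, ha⟩ := Field.exists_primitive_element F K
  refine ⟨a, a.2, ?_⟩
  have h1 := lift_adjoin_simple F K a
  rw [ha, lift_top] at h1
  exact h1

/-- **An integral generator.** For algebraic `y₁, …, yₙ ∈ ℂ` there are an algebraic integer `α`
(an integer multiple of a primitive element of `ℚ(y₁, …, yₙ)`), integer polynomials `R_i` and an
integer `c ≠ 0` with `c · y_i = R_i(α)` for all `i`. [folklore] -/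
theorem exists_generator {n : ℕ} (y : Fin n → ℂ) (halg : ∀ i, IsAlgebraic ℚ (y i)) :
    ∃ (α : ℂ) (R : Fin n → ℤ[X]) (c : ℤ), IsIntegral ℤ α ∧ c ≠ 0 ∧
      ∀ i, (c : ℂ) * y i = Polynomial.aeval α (R i) := by
  classical
  -- the number field `K = ℚ(y) = ℚ(a)`
  set K : IntermediateField ℚ ℂ := adjoin ℚ (Set.range y) with hK
  have hint : ∀ x ∈ Set.range y, IsIntegral ℚ x := by
    rintro _ ⟨i, rfl⟩
    exact (halg i).isIntegral
  haveI : FiniteDimensional ℚ K := finiteDimensional_adjoin hint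
  obtain ⟨a, haK, hKa⟩ := exists_eq_adjoin_simple K
  have haint : IsIntegral ℚ a := by
    have h : Algebra.IsIntegral ℚ K := inferInstance
    exact (IntermediateField.isIntegral_iff (K := ℚ)).mp (h.isIntegral ⟨a, haK⟩)
  -- every `y_i` is a rational polynomial in `a`
  have hy : ∀ i, ∃ f : ℚ[X], y i = Polynomial.aeval a f := by
    intro i
    have h1 : y i ∈ K := subset_adjoin ℚ _ ⟨i, rfl⟩
    rw [hKa] at h1
    have h2 : y i ∈ (adjoin ℚ {a}).toSubalgebra := h1
    rw [adjoin_simple_toSubalgebra_of_isAlgebraic haint.isAlgebraic,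
      Algebra.adjoin_singleton_eq_range_aeval] at h2
    obtain ⟨f, hf⟩ := h2
    exact ⟨f, hf.symm⟩
  choose f hf using hy
  -- an integer multiple `α = N a` which is an algebraic integer
  have halgZ : IsAlgebraic ℤ a := (IsFractionRing.isAlgebraic_iff ℤ ℚ ℂ).mpr haint.isAlgebraic
  obtain ⟨N, hN0, hNint⟩ := halgZ.exists_integral_multiple
  rw [zsmul_eq_mul] at hNint
  -- a common denominator `b` for the coefficients of the `f_i`
  set e : ℕ := Finset.univ.sup fun i => (f i).natDegree with he
  have hfe : ∀ i, (f i).natDegree < e + 1 := fun i =>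
    Nat.lt_succ_of_le (Finset.le_sup (f := fun i => (f i).natDegree) (mem_univ i))
  obtain ⟨b, hb⟩ := IsLocalization.exist_integer_multiples (nonZeroDivisors ℤ)
    (Finset.univ : Finset (Fin n × Fin (e + 1))) (fun ik => ((f ik.1).coeff ik.2 : ℚ))
  have hz : ∀ (i : Fin n) (k : Fin (e + 1)), ∃ z : ℤ, (z : ℚ) = (b : ℤ) * (f i).coeff k := by
    intro i k
    obtain ⟨z, hz⟩ := hb (i, k) (mem_univ _)
    refine ⟨z, ?_⟩
    rw [zsmul_eq_mul] at hz
    simpa using hz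
  choose z hz using hz
  have hb0 : (b : ℤ) ≠ 0 := nonZeroDivisors.coe_ne_zero b
  -- the data
  refine ⟨(N : ℂ) * a, fun i => ∑ k : Fin (e + 1),
    Polynomial.C (z i k * N ^ (e - k)) * Polynomial.X ^ (k : ℕ), b * N ^ e, hNint,
    mul_ne_zero hb0 (pow_ne_zero _ hN0), fun i => ?_⟩
  -- `b N^e y_i = ∑_k z_{ik} N^{e-k} (N a)^k`
  have hfi : Polynomial.aeval a (f i) = ∑ k : Fin (e + 1), ((f i).coeff k : ℂ) * a ^ (k : ℕ) := by
    rw [Polynomial.aeval_eq_sum_range' (hfe i), ← Fin.sum_univ_eq_sum_range]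
    refine sum_congr rfl fun k _ => ?_
    rw [Algebra.smul_def, eq_ratCast]
  rw [map_sum, hf i, hfi, Int.cast_mul, Int.cast_pow, mul_assoc, mul_sum, mul_sum]
  refine sum_congr rfl fun k _ => ?_
  have hk : (k : ℕ) ≤ e := Nat.lt_succ_iff.mp k.isLt
  rw [map_mul, map_pow, Polynomial.aeval_X, Polynomial.aeval_C]
  simp only [algebraMap_int_eq, eq_intCast, Int.cast_mul, Int.cast_pow]
  have hzk : ((z i k : ℤ) : ℂ) = (b : ℂ) * ((f i).coeff k : ℂ) := by
    have := congrArg (fun q : ℚ => (q : ℂ)) (hz i k)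
    push_cast at this
    exact this
  rw [hzk]
  have eN : (N : ℂ) ^ e = (N : ℂ) ^ (e - k) * (N : ℂ) ^ (k : ℕ) := by
    rw [← pow_add, Nat.sub_add_cancel hk]
  rw [eN, mul_pow]
  ring

/-! ### Liouville's inequality for `h₁y₁ + ⋯ + hₙyₙ` -/

/-- The integer combination `∑ hᵢ Rᵢ ∈ ℤ[X]` of the numerator polynomials. [folklore] -/
theorem zl1_sum_C_mul_le {n : ℕ} (R : Fin n → ℤ[X]) (h : Fin n → ℤ) {A : ℝ}
    (hA : ∀ i, zl1 (R i) ≤ A) :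
    zl1 (∑ i, Polynomial.C (h i) * R i) ≤ (∑ i, |(h i : ℝ)|) * A := by
  rw [pl1Seminorm_apply, sum_mul]
  refine (pwnorm_sum_le _ _ _).trans (sum_le_sum fun i _ => ?_)
  have := map_mul_le_mul zl1 (Polynomial.C (h i)) (R i)
  rw [Chudnovsky.zl1_C] at this
  rw [← pl1Seminorm_apply]
  exact this.trans (mul_le_mul_of_nonneg_left (hA i) (abs_nonneg _))

/-- **Liouville's inequality for a linear form in `ℚ`-linearly independent algebraic numbers**:
there are `c > 0` and `k` with `c ≤ (∑|hᵢ|)^k · |∑ hᵢyᵢ|` for every non-zero `h ∈ ℤⁿ`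
(reduction to `LiouvilleLinearForms`: `c·∑hᵢyᵢ` is an integer polynomial in an integral generator
`α`, of degree `< deg α` after reduction modulo the minimal polynomial, with coefficients
`O(∑|hᵢ|)`). [cite: NesterenkoPhilippon2001, Ch. 14 §3.3 p. 258 (Liouville's inequality)] -/
theorem exists_lowerBound_linearForm {n : ℕ} (y : Fin n → ℂ) (halg : ∀ i, IsAlgebraic ℚ (y i))
    (hli : LinearIndependent ℚ y) :
    ∃ c : ℝ, 0 < c ∧ ∃ k : ℕ, ∀ h : Fin n → ℤ, h ≠ 0 →
      c ≤ (∑ i, |(h i : ℝ)|) ^ k * ‖∑ i, (h i : ℂ) * y i‖ := by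
  classical
  obtain ⟨α, R, c, hαint, hc0, hR⟩ := exists_generator y halg
  -- the minimal polynomial of `α`
  set μ : ℤ[X] := minpoly ℤ α with hμ
  have hμmonic : μ.Monic := minpoly.monic hαint
  have hμα : Polynomial.aeval α μ = 0 := minpoly.aeval ℤ α
  set d : ℕ := μ.natDegree with hd
  have hd0 : 0 < d := minpoly.natDegree_pos hαint
  have hdQ : (minpoly ℚ α).natDegree = d := by
    rw [minpoly.isIntegrallyClosed_eq_field_fractions' ℚ hαint, hμmonic.natDegree_map]
  obtain ⟨cL, hcL, k, hL⟩ := exists_pos_le_sum_abs_pow_mul_norm_linearForm_pow α hdQ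
  -- sizes of the `R_i`
  set A : ℝ := max 1 ((∑ i, zl1 (R i)) * (1 + zl1 μ) ^ (Finset.univ.sup fun i => (R i).natDegree))
    with hA
  have hA1 : 1 ≤ A := le_max_left _ _
  have hA0 : 0 < A := lt_of_lt_of_le one_pos hA1
  have hcabs : 0 < |(c : ℝ)| := abs_pos.mpr (Int.cast_ne_zero.mpr hc0)
  refine ⟨cL / (A ^ k * |(c : ℝ)|), div_pos hcL (mul_pos (pow_pos hA0 _) hcabs), k, fun h hh => ?_⟩
  -- the reduced polynomial `q = red μ (∑ hᵢ Rᵢ)` and its coefficient vector `g`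
  set ph : ℤ[X] := ∑ i, Polynomial.C (h i) * R i with hph
  set q : ℤ[X] := red μ ph with hq
  have hqdeg : q.natDegree < d := natDegree_red_lt hμmonic hd0 ph
  set g : Fin d → ℤ := fun e => q.coeff e with hg
  -- `∑ g_e α^e = c ∑ hᵢ yᵢ`
  have hsum : ∑ e : Fin d, (g e : ℂ) * α ^ (e : ℕ) = (c : ℂ) * ∑ i, (h i : ℂ) * y i := by
    have h1 : Polynomial.aeval α q = ∑ e : Fin d, (g e : ℂ) * α ^ (e : ℕ) := by
      rw [Polynomial.aeval_eq_sum_range' hqdeg, ← Fin.sum_univ_eq_sum_range]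
      refine sum_congr rfl fun e _ => ?_
      rw [Algebra.smul_def, algebraMap_int_eq, eq_intCast]
    rw [← h1, hq, aeval_red μ ph hμα, hph, map_sum, mul_sum]
    refine sum_congr rfl fun i _ => ?_
    rw [map_mul, Polynomial.aeval_C, algebraMap_int_eq, eq_intCast, ← hR i]
    ring
  -- `g ≠ 0` by the linear independence of `y`
  have hg0 : g ≠ 0 := by
    intro hg0
    have h0 : (c : ℂ) * ∑ i, (h i : ℂ) * y i = 0 := by
      rw [← hsum]
      exact sum_eq_zero fun e _ => by rw [show g e = 0 from congrFun hg0 e]; simp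
    have h1 : ∑ i, (h i : ℂ) * y i = 0 := by
      rcases mul_eq_zero.mp h0 with h' | h'
      · exact absurd h' (Int.cast_ne_zero.mpr hc0)
      · exact h'
    apply hh
    have key := Fintype.linearIndependent_iff.mp hli (fun i => (h i : ℚ)) ?_
    · funext i
      exact_mod_cast key i
    · rw [← h1]
      refine sum_congr rfl fun i _ => ?_
      rw [Rat.smul_def]
      push_cast
      rfl
  -- the size of `g`
  have hgsize : ∑ e : Fin d, |(g e : ℝ)| ≤ (∑ i, |(h i : ℝ)|) * A := by
    have h1 : ∑ e : Fin d, |(g e : ℝ)| ≤ zl1 q := by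
      have hsub : q.support ⊆ Finset.range d := fun e he => by
        rw [Finset.mem_range]
        exact lt_of_le_of_lt (Polynomial.le_natDegree_of_mem_supp e he) hqdeg
      rw [pl1Seminorm_apply, Chudnovsky.pwnorm_eq_sum_of_subset _ hsub,
        ← Fin.sum_univ_eq_sum_range (fun e => (normRingSeminorm ℤ) (q.coeff e)) d]
      refine le_of_eq (sum_congr rfl fun e _ => ?_)
      rw [normRingSeminorm_int_apply]
    have h2 : zl1 q ≤ zl1 ph * (1 + zl1 μ) ^ (Finset.univ.sup fun i => (R i).natDegree) := by
      refine zl1_red_le_of_natDegree_le μ ?_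
      rw [hph]
      refine (Polynomial.natDegree_sum_le _ _).trans ?_
      rw [Finset.fold_max_le]
      refine ⟨Nat.zero_le _, fun i _ => Polynomial.natDegree_mul_le.trans ?_⟩
      rw [Polynomial.natDegree_C, zero_add]
      exact Finset.le_sup (f := fun i => (R i).natDegree) (mem_univ i)
    have h3 : zl1 ph ≤ (∑ i, |(h i : ℝ)|) * ∑ i, zl1 (R i) :=
      zl1_sum_C_mul_le R h fun i =>
        single_le_sum (f := fun i => zl1 (R i)) (fun i _ => apply_nonneg _ _) (mem_univ i)
    have hS0 : 0 ≤ ∑ i, |(h i : ℝ)| := sum_nonneg fun i _ => abs_nonneg _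
    have hpow : 0 ≤ (1 + zl1 μ) ^ (Finset.univ.sup fun i => (R i).natDegree) :=
      pow_nonneg (add_nonneg zero_le_one (apply_nonneg _ _)) _
    calc ∑ e : Fin d, |(g e : ℝ)| ≤ zl1 q := h1
      _ ≤ zl1 ph * (1 + zl1 μ) ^ (Finset.univ.sup fun i => (R i).natDegree) := h2
      _ ≤ (∑ i, |(h i : ℝ)|) * ((∑ i, zl1 (R i)) *
            (1 + zl1 μ) ^ (Finset.univ.sup fun i => (R i).natDegree)) := by
          rw [← mul_assoc]
          exact mul_le_mul_of_nonneg_right h3 hpow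
      _ ≤ (∑ i, |(h i : ℝ)|) * A := mul_le_mul_of_nonneg_left (le_max_right _ _) hS0
  -- Liouville for `g` and division by `|c| A^k`
  have key := hL g hg0
  rw [hsum, norm_mul, Complex.norm_intCast] at key
  have hS0 : 0 ≤ ∑ i, |(h i : ℝ)| := sum_nonneg fun i _ => abs_nonneg _
  have hpow : (∑ e : Fin d, |(g e : ℝ)|) ^ k ≤ ((∑ i, |(h i : ℝ)|) * A) ^ k :=
    pow_le_pow_left₀ (sum_nonneg fun e _ => abs_nonneg _) hgsize k
  have hN0 : 0 ≤ ‖∑ i, (h i : ℂ) * y i‖ := norm_nonneg _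
  rw [div_le_iff₀ (mul_pos (pow_pos hA0 _) hcabs)]
  calc cL ≤ (∑ e : Fin d, |(g e : ℝ)|) ^ k * (|(c : ℝ)| * ‖∑ i, (h i : ℂ) * y i‖) := key
    _ ≤ ((∑ i, |(h i : ℝ)|) * A) ^ k * (|(c : ℝ)| * ‖∑ i, (h i : ℂ) * y i‖) :=
        mul_le_mul_of_nonneg_right hpow (mul_nonneg hcabs.le hN0)
    _ = (∑ i, |(h i : ℝ)|) ^ k * ‖∑ i, (h i : ℂ) * y i‖ * (A ^ k * |(c : ℝ)|) := by
        rw [mul_pow]; ring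

/-! ### Root separation -/

/-- **Roots of a non-zero polynomial are isolated**: for `p ∈ ℤ[X] ∖ 0` and `α ∈ ℂ` there is
`ε > 0` such that the only possible root of `p` within `ε` of `α` is `α` itself. [folklore] -/
theorem exists_root_separation (p : ℤ[X]) (hp : p ≠ 0) (α : ℂ) :
    ∃ ε : ℝ, 0 < ε ∧ ∀ z : ℂ, Polynomial.aeval z p = 0 → ‖z - α‖ < ε → z = α := by
  classical
  set S : Finset ℂ := ((p.map (Int.castRingHom ℂ)).roots.toFinset).erase α with hS
  have hmap : p.map (Int.castRingHom ℂ) ≠ 0 :=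
    (Polynomial.map_ne_zero_iff (Int.castRingHom ℂ).injective_int).mpr hp
  have hmem : ∀ z : ℂ, Polynomial.aeval z p = 0 → z ≠ α → z ∈ S := by
    intro z hz hne
    rw [hS, Finset.mem_erase, Multiset.mem_toFinset, Polynomial.mem_roots hmap,
      Polynomial.IsRoot.def, Polynomial.eval_map]
    refine ⟨hne, ?_⟩
    rwa [Polynomial.aeval_def, algebraMap_int_eq] at hz
  by_cases hne : S.Nonempty
  · obtain ⟨z₀, hz₀, hmin⟩ := Finset.exists_min_image S (fun z => ‖z - α‖) hne
    have hpos : 0 < ‖z₀ - α‖ := by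
      rw [norm_pos_iff, sub_ne_zero]
      exact (Finset.mem_erase.mp hz₀).1
    refine ⟨‖z₀ - α‖, hpos, fun z hz hlt => ?_⟩
    by_contra hzα
    exact absurd (hmin z (hmem z hz hzα)) (not_le.mpr hlt)
  · refine ⟨1, one_pos, fun z hz _ => ?_⟩
    by_contra hzα
    exact hne ⟨z, hmem z hz hzα⟩

end LWMeasure

end Literature.NumberTheory.Transcendental

end
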